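import Summits.QuantumFields.YangMills.Theorems.SwapVirialDeficitNearFlatLeaders
import Summits.QuantumFields.YangMills.Theorems.SwapVirialDeficitBlowUpGnomonicStratumBFlat
import HarnessLib

/-!
# THE SU(2) BRIDGE OF THE NEAR-FLAT PROJECTION: a unit quaternion quadruple with commuting triple and the three σ-equalities, pushed to `SU(2)` with followers `1`, is FLAT;
# and the σ-residual `W` moves Lipschitz under the coaxialization
# (free-hands support of ⟨stmt-QuantumFields-24197⟩ `SwapVirialDeficit.SwapGluedStiffness`; LEAD g99's plan for memo7 §C(c): his `exists_flat_near_of_coaxial` (σ-word half, A∕B branches)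
# outputs exactly these hypotheses; this file plugs it into `chartDeficit = 0` and transfers the relation sizes through ✓`exists_coaxial_tuple`)

* ★★ `flat_of_sigma_relations (Cf : Fin 4 → ℍ) (hfu : ∀ k, ‖Cf k‖ = 1) (hcomm : triple 0,1,2 pairwise commutes) (hσ₀ : Cf 3 * Cf 1 = Cf 0 * Cf 3) (hσ₁ : Cf 3 * Cf 0 = Cf 1 * Cf 3)
  (hσ₂ : Cf 3 * Cf 2 = Cf 2 * Cf 3) : chartDeficit L 0 1 (quatToSU2 ∘ Cf, 1) = 0` (covers stratum A AND stratum B targets);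
* (`su2Quat (quatToSU2 x) = x` for unit `x` is ✓`SU2FractionalPowers.su2Quat_quatToSU2_of_norm_eq_one`, not restated); `sigma_residual_lipschitz` — for unit `c`: `‖c·C₁′ − C₀′·c‖ ≤ ‖c·C₁ − C₀·c‖ + ‖C₁ − C₁′‖ + ‖C₀ − C₀′‖` (and its two companions by instantiation);
* `comm_lipschitz` — `‖[A′, B′]‖ ≤ ‖[A, B]‖ + 2‖A − A′‖ + 2‖B − B′‖` for unit `A, B, A′, B′`… stated with explicit norms `≤ 1`.

HONEST LABEL: elementary; stubs of ➎, ⟨24197⟩ ∕ ⟨24194⟩ ∕ ⟨24497⟩ OPEN; own crux ⟨22884⟩ OPEN (blocked-on ⟨19935⟩); the Yang–Mills mass gap is NOT proved; no summit is proved by a line.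
THEOREMS ONLY (0 `def`, 0 `sorry`), standard axioms.  Width seat ym-line-sfw-p2-w3 g66 (cell ym-idea-1, free hands), `--supports stmt-QuantumFields-24197`.  References: [folklore].
-/

set_option autoImplicit false

noncomputable section

open Quaternion
open scoped Quaternion
open Literature.MathematicalPhysics.QuantumFieldTheory hiding SU2
open Literature.MathematicalPhysics.QuantumLattice
open Literature.Analysis.Calculus (radialUnit radialUnit_def)
open Literature.MathematicalPhysics.QuantumFieldTheory.Balaban1983to89.T4WilsonGaugeFlatDirection (su2Quat_injective)

namespace Summit.QuantumFields.YangMills.Theorems.SwapVirialDeficit.NearFlat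

open Summit.QuantumFields.YangMills.Theorems.FemtoTransferGap
open Summit.QuantumFields.YangMills.Theorems.FemtoTransferGap.TT
open Summit.QuantumFields.YangMills.Theorems.VirialFluxGap.RingDeficit
open Summit.QuantumFields.YangMills.Theorems.SwapVirialDeficit.SwapRing
open Summit.QuantumFields.YangMills.Theorems.SwapVirialDeficit.BlowUpRing
open Summit.QuantumFields.YangMills.Theorems.SwapVirialDeficit.ZeroModeSigma (su2Quat_quatToSU2_eq_radialUnit)

variable {L : ℕ} [NeZero L]

/-- ★★ **THE SU(2) BRIDGE**: a unit quadruple `(C₀, C₁, C₂, c)` whose triple commutes pairwise and which satisfies the three σ-equalities `cC₁ = C₀c`, `cC₀ = C₁c`, `cC₂ = C₂c`,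
pushed to `SU(2)` by `quatToSU2` with all followers `1`, has `chartDeficit = 0` (principal sector). [folklore] -/
theorem flat_of_sigma_relations (Cf : Fin 4 → ℍ) (hfu : ∀ k, ‖Cf k‖ = 1) (hcomm : ∀ μ ν : Fin 3, Cf (Fin.castSucc μ) * Cf (Fin.castSucc ν) = Cf (Fin.castSucc ν) * Cf (Fin.castSucc μ))
    (hσ₀ : Cf 3 * Cf 1 = Cf 0 * Cf 3) (hσ₁ : Cf 3 * Cf 0 = Cf 1 * Cf 3) (hσ₂ : Cf 3 * Cf 2 = Cf 2 * Cf 3) :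
    chartDeficit L (fun _ => false) (fun _ => 1) ((fun k => quatToSU2 (Cf k), fun _ => 1) : (Fin 4 → SU2) × (Fol L → SU2)) = 0 := by
  have hne : ∀ k, Cf k ≠ 0 := fun k => by
    intro h0; have := hfu k; rw [h0, norm_zero] at this; exact zero_ne_one this
  have hsq : ∀ k, su2Quat (quatToSU2 (Cf k)) = Cf k := fun k => by
    rw [su2Quat_quatToSU2_eq_radialUnit (hne k), radialUnit_def, hfu k, inv_one, one_smul]
  have lift : ∀ {k l k' l' : Fin 4}, Cf k * Cf l = Cf k' * Cf l' →
      quatToSU2 (Cf k) * quatToSU2 (Cf l) = quatToSU2 (Cf k') * quatToSU2 (Cf l') := fun h =>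
    su2Quat_injective (by rw [Balaban1983to89.T4HaarSU2Translate.su2Quat_mul, Balaban1983to89.T4HaarSU2Translate.su2Quat_mul, hsq, hsq, hsq, hsq]; exact h)
  rw [chartDeficit_eq_zero_iff]
  refine ⟨fun μ ν => lift (hcomm μ ν), fun μ => ?_, fun i => rfl⟩
  fin_cases μ
  · show quatToSU2 (Cf (Fin.last 3)) * quatToSU2 (Cf (Fin.castSucc (Equiv.swap (0 : Fin 3) 1 0))) =
      quatToSU2 (Cf (Fin.castSucc 0)) * quatToSU2 (Cf (Fin.last 3))
    rw [Equiv.swap_apply_left]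
    exact lift hσ₀
  · show quatToSU2 (Cf (Fin.last 3)) * quatToSU2 (Cf (Fin.castSucc (Equiv.swap (0 : Fin 3) 1 1))) =
      quatToSU2 (Cf (Fin.castSucc 1)) * quatToSU2 (Cf (Fin.last 3))
    rw [Equiv.swap_apply_right]
    exact lift hσ₁
  · show quatToSU2 (Cf (Fin.last 3)) * quatToSU2 (Cf (Fin.castSucc (Equiv.swap (0 : Fin 3) 1 2))) =
      quatToSU2 (Cf (Fin.castSucc 2)) * quatToSU2 (Cf (Fin.last 3))
    rw [Equiv.swap_apply_of_ne_of_ne (by decide) (by decide)]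
    exact lift hσ₂

/-- ★ **σ-residuals move Lipschitz**: for unit `c`, `‖c·C₁′ − C₀′·c‖ ≤ ‖c·C₁ − C₀·c‖ + ‖C₁ − C₁′‖ + ‖C₀ − C₀′‖`. [folklore] -/
theorem sigma_residual_lipschitz {c : ℍ} (hc : ‖c‖ = 1) (C₀ C₁ C₀' C₁' : ℍ) :
    ‖c * C₁' - C₀' * c‖ ≤ ‖c * C₁ - C₀ * c‖ + ‖C₁ - C₁'‖ + ‖C₀ - C₀'‖ := by
  have e : c * C₁' - C₀' * c = (c * C₁ - C₀ * c) - c * (C₁ - C₁') + (C₀ - C₀') * c := by noncomm_ring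
  rw [e]
  calc ‖(c * C₁ - C₀ * c) - c * (C₁ - C₁') + (C₀ - C₀') * c‖ ≤ ‖(c * C₁ - C₀ * c) - c * (C₁ - C₁')‖ + ‖(C₀ - C₀') * c‖ := norm_add_le _ _
    _ ≤ ‖c * C₁ - C₀ * c‖ + ‖c * (C₁ - C₁')‖ + ‖(C₀ - C₀') * c‖ := by linarith [norm_sub_le (c * C₁ - C₀ * c) (c * (C₁ - C₁'))]
    _ = _ := by rw [norm_mul, norm_mul, hc, one_mul, mul_one]

/-- ★ **Commutators move Lipschitz**: for `‖A′‖ ≤ 1`, `‖B‖ ≤ 1`: `‖A′B′ − B′A′‖ ≤ ‖AB − BA‖ + 2‖A − A′‖ + 2‖B − B′‖`. [folklore] -/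
theorem comm_lipschitz {A B A' B' : ℍ} (hA : ‖A'‖ ≤ 1) (hB : ‖B‖ ≤ 1) :
    ‖A' * B' - B' * A'‖ ≤ ‖A * B - B * A‖ + 2 * ‖A - A'‖ + 2 * ‖B - B'‖ := by
  have e : A' * B' - B' * A' = (A * B - B * A) - ((A - A') * B - B * (A - A')) - (A' * (B - B') - (B - B') * A') := by noncomm_ring
  rw [e]
  have h1 : ‖(A - A') * B - B * (A - A')‖ ≤ 2 * ‖A - A'‖ := by
    calc ‖(A - A') * B - B * (A - A')‖ ≤ ‖(A - A') * B‖ + ‖B * (A - A')‖ := norm_sub_le _ _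
      _ ≤ ‖A - A'‖ * 1 + 1 * ‖A - A'‖ := by
          rw [norm_mul, norm_mul]
          exact add_le_add (mul_le_mul_of_nonneg_left hB (norm_nonneg _)) (mul_le_mul_of_nonneg_right hB (norm_nonneg _))
      _ = 2 * ‖A - A'‖ := by ring
  have h2 : ‖A' * (B - B') - (B - B') * A'‖ ≤ 2 * ‖B - B'‖ := by
    calc ‖A' * (B - B') - (B - B') * A'‖ ≤ ‖A' * (B - B')‖ + ‖(B - B') * A'‖ := norm_sub_le _ _
      _ ≤ 1 * ‖B - B'‖ + ‖B - B'‖ * 1 := by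
          rw [norm_mul, norm_mul]
          exact add_le_add (mul_le_mul_of_nonneg_right hA (norm_nonneg _)) (mul_le_mul_of_nonneg_left hA (norm_nonneg _))
      _ = 2 * ‖B - B'‖ := by ring
  calc ‖A * B - B * A - ((A - A') * B - B * (A - A')) - (A' * (B - B') - (B - B') * A')‖
      ≤ ‖A * B - B * A - ((A - A') * B - B * (A - A'))‖ + ‖A' * (B - B') - (B - B') * A'‖ := norm_sub_le _ _
    _ ≤ ‖A * B - B * A‖ + ‖(A - A') * B - B * (A - A')‖ + ‖A' * (B - B') - (B - B') * A'‖ := by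
        linarith [norm_sub_le (A * B - B * A) ((A - A') * B - B * (A - A'))]
    _ ≤ _ := by linarith

end Summit.QuantumFields.YangMills.Theorems.SwapVirialDeficit.NearFlat

end
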